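import Summits.AtomisticToContinuum.Crystallization.Theorems.FreeSplittingCertificatesStrictSplittingRuleDefs
import Summits.AtomisticToContinuum.Crystallization.Theorems.FreeSplittingCertificatesStrictSplittingRulePerturbativeReduction
import Summits.AtomisticToContinuum.Crystallization.Theorems.FreeSplittingCertificatesStrictSplittingRuleHcpFamilyMinLocalised
import Summits.AtomisticToContinuum.Crystallization.Theorems.FreeSplittingCertificatesSlackDensity
import Summits.AtomisticToContinuum.Crystallization.Theorems.PalmUnimodularRigidityLayeredLawsSelectHcpZeroStress
import Summits.AtomisticToContinuum.Crystallization.Theorems.PalmUnimodularRigidityLayeredLawsSelectHcpSublatticeForce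
import Summits.AtomisticToContinuum.Crystallization.Theorems.PricedLinkCensusStackingHingeFarTail
import Literature.MathematicalPhysics.StatisticalMechanics.LennardJonesClusters
import Literature.MathematicalPhysics.StatisticalMechanics.MuGSC

/-!
# `StrictSplittingRule` (stmt-AtomisticToContinuum-12560), line `birth`: the core's kill criterion (Hall inequality) and proved pieces

(Wave-2 worker file of stub `stub_perturbativeCore`, landed by the lead with anchor `stub_coreHall`; the three-piece
SPLIT of the core — `CoreFirstOrderDesign`, `CoreSitewiseHarmonic`, `CoreAssembly` and the reduction — is the sibling
definition file `…StrictSplittingRuleCoreDefs.lean`.)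

The registered stub `stub_perturbativeCore` (sitewise, finite-range-redistributed first-AND-second-order
coercivity of the relaxed Lennard-Jones hcp crystal on the good–good subgraph, threshold `e = e(hcp(a,h))` at
the family minimiser, ZERO budget) is NOT proved here.  This file records, sorry-free:

## (A) No cheap kill — and the exact kill criterion (`core_hall`)

`core_hall`: `PerturbativeCore δ a t η₀ e` forces, for EVERY finite `δ`-separated configuration and EVERY
set `S` of good sites, `|S|·e ≤ E(S) := Σ_{pairs ⊂ S} V_LJ` (sum the site inequalities over `S`;
complementarity + the realised-pattern swap make the `S × S` part rule-independent, and bonds leaving `S` only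
help because every bond at a good site is attractive, `r > 0.98a ≥ 0.9`).  This is the ONLY rule-independent
necessary condition we found, and it cannot be violated cheaply: `E(S) ≥ E(|S|) ≥ |S|·e_∞` (Fekete), so a
witness `E(S) < |S|·e(hcp(a,h))` would exhibit `e_∞ < e(hcp)` BY (a/100)-GOOD CLUSTERS, i.e. refute "relaxed
hcp is an LJ ground state" inside the 1 % tube.  Numerics (`tmp/core/killcheck.py`, `V = r⁻¹²/12 − r⁻⁶/6`,
`a* = 0.97129`, `h* = 0.79294`): `e(hcp) = −0.7176`, `V′(a*) = −0.2342`, `V″(a*) = 10.71`, `V‴(a*) = −209`;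
breathing a shell by `a/100`: first order `6V′ε = −0.01365` (must be transferred EXACTLY), second `+0.00303`,
cubic `−0.00019`; family strain 1 %: `+0.0026`/site (second order, `HcpFamilyMin`); stacking fault: the
single c-layer is bad and its two good neighbours gain `≈ +0.20`/site of dropped bonds; hcp balls:
`E(S)/|S| − e ≈ +0.54·(surface)/|S| > 0`.  Locality kills also fail: the far-field FIRST-order imbalance at a
site (`≈ 1.0·tr ε·ℓ⁻³` from bonds longer than `ℓ`, first order, both signs) IS transferable by far-bond
weights that read only the nearest-neighbour bond lengths at the far endpoint: the required coefficients solve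
an exterior TRUSS problem (radial loads `½V′(r) r̂ ~ r⁻⁷`, hcp contact framework, member forces `≈ 0.19 r⁻⁶`),
within the bond capacity `|V(r)| = r⁻⁶/6` at strains `≤ 3 %` (`12·(0.19·6)·0.03 ≈ 0.4 < ½`).
Verdict: no `stub-false` witness; the statement stands or falls with a SITEWISE sum-of-squares decomposition of
the hcp force constants (below, H2), which is open (crux `PhononStability`, stmt-…-9333, is only the GLOBAL
inequality and is itself open).

## (B) The three pieces (`CoreFirstOrderDesign`, `CoreSitewiseHarmonic`, `CoreAssembly`) and the reduction

All three are lattice-side / assembly statements over `hcpSite`, `ljSqDeriv` (`W′`, `V(r) = W(r²)`),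
`HcpFamilyMin`, `PerturbativeCore`; `stub_perturbativeCore_of_pieces` is the registered signature VERBATIM from
them (so the lead may register H1–H3 as stubs replacing the core; the three `def`s belong in the Defs file).
* H1 `CoreFirstOrderDesign a h` — FIRST-ORDER DESIGN (radial, frame-free): Bravais-covariant transfer
  coefficients `β(parity, index difference, stencil label)`, decaying like `(1 + r)⁻⁶`, whose antisymmetrised
  bond transfers (each end reads only its own stencil bond-length changes `⟨y_{p+s} − y_p, u_{p+s} − u_p⟩`)
  cancel the naive half-split first variation `Σ_q W′(‖y_q − y_p‖²)⟨y_q − y_p, u_q − u_p⟩` at EVERY site, for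
  every finitely supported displacement field.  Inputs landed: zero site stress at the family minimiser
  (`core_zeroStress`, from `stub_zeroStress`) and zero sublattice forces (`sublatticeForce_vanishes`); what
  remains is the augmentation-ideal (`I/I² ≅ ℝ³`) algebra near the root and the exterior truss with `r⁻⁶`
  decay.  Believed PROVABLE NOW (size M–L).  Numerical consistency test (`tmp/core/truss_h1_pure.py`: potential
  truncated to a fixed index set, `(a,h)` re-minimised so the truncated stress vanishes, both root parities,
  nearest-neighbour stencils): least-squares relative residual `2.6·10⁻⁹` (68 neighbours, 1098 equations, 1632
  unknowns) and `6.5·10⁻¹⁰` (160 neighbours, 2046 / 3792), at the level of the stress left by the minimiser —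
  no obstruction beyond force / torque / stress; nn coefficients `|β| ≤ 6.8·10⁻³` (5 % of `½|V(a)|` at 3 %
  strain).  Fallback weakening if the radial stencil is too rigid: vector stencil coefficients with zero
  torque `Σ_s y_s × α_s = 0` (still frame-free realisable).
* H2 `CoreSitewiseHarmonic a h` — SITEWISE HARMONIC COERCIVITY: decaying, Bravais-covariant QUADRATIC radial
  transfers making every site's naive half-split second variation `½Σ_q [W′‖Δu‖² + 2W″⟨Δy,Δu⟩²]` plus transfers
  `≥ κ·Σ_{nn}⟨Δy,Δu⟩²` (coercive in bond stretches: rotations are exact zero modes).  Equivalent to a local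
  sum-of-Hermitian-squares decomposition of the hcp dynamical matrix modulo rigid motions (near field) — OPEN,
  9333-hard or harder (9333 = its sum over sites + Korn); the far field (`W″ < 0` beyond the inflection) is
  chargeable along segments to longitudinal strains with `r⁻⁶` coefficients.  Morally NECESSARY for the core.
* H3 `CoreAssembly` — `H1 → H2 → core`: build `Φ₀ = ½ + λ`, `λ` the antisymmetrisation (`core_antisymm_of_half`,
  `core_isRule_halfAdd`) of "first-order + second-order transfer read in the endpoint's shell", charts of all-good
  regions, cubic Taylor remainders up to `η₀ = a/100` (needs `κ` of H2 against `|V‴/V″| ≈ 20`), defect slack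
  (every defect is wrapped in bad sites; dropped bonds give `~ρ⁻⁶` at distance `ρ`, dominating the `O(η₀ρ⁻⁶)`
  bookkeeping errors), far tails (`core_weightedTail`).  Size L–XL, true iff the core is (given H1, H2).

## (C) Proved here
`core_isRule_halfAdd`, `core_antisymm_of_half` (rule construction), `core_goodSum_halfAdd`, `core_hall` /
`core_hall_familyMin` (kill criterion), `core_zeroStress` (+ `core_firstOrderInputs`), `core_weightedTail` (rule-independent far tail
`|Σ_{r ≥ L} w·V| ≤ C L⁻³`).  (The reduction `stub_perturbativeCoreOfPieces` and the three pieces are in `…CoreDefs.lean`.)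

Sources: FrieseckeTheil2002, EMing2006, HudsonOrtner2011, BlancLewin2015 §2, Stillinger2001.  All `[folklore]`.
-/

noncomputable section

namespace Summit.AtomisticToContinuum.Crystallization.Theorems.StrictSplittingRuleBirth

open scoped BigOperators Classical
open Literature.MathematicalPhysics.StatisticalMechanics
open Literature.Geometry.DiscreteGeometry
open Summit.AtomisticToContinuum.Crystallization.Theorems.PalmUnimodularRigidity.LayeredLawsSelectHcp
  (hcpE hcpQ hcpSite ljSqDeriv hcpSiteStress stub_zeroStress sublatticeForce_vanishes)
open Summit.AtomisticToContinuum.Crystallization.Theorems.ExcessDecayLiouvilleCoarseGrains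
  (hcpEnergySeries_of_eq)

/-- Euclidean `3`-space. -/
local notation "E3" => EuclideanSpace ℝ (Fin 3)

/-! ## §1  Rules of the form `½ + λ` -/

/-- **A bounded antisymmetric transfer on top of the even split is a rule**: `|λ| ≤ ½` gives the box and
`λ(−v, T − v) = −λ(v, T)` gives complementarity for `Φ₀ = ½ + λ`. [folklore] -/
theorem core_isRule_halfAdd (lam : E3 → Finset E3 → ℝ) (hb : ∀ v T, |lam v T| ≤ 1 / 2)
    (hanti : ∀ v T, v ≠ 0 → lam (-v) (T.image fun u => u - v) = -lam v T) :
    IsRule (fun v T => 1 / 2 + lam v T) := by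
  refine ⟨fun v T => ?_, fun v T hv => ?_⟩
  · have h := abs_le.1 (hb v T)
    exact ⟨by linarith [h.1], by linarith [h.2]⟩
  · show 1 / 2 + lam v T + (1 / 2 + lam (-v) (T.image fun u => u - v)) = 1
    rw [hanti v T hv]
    ring

/-- **Antisymmetrisation of a half-transfer.**  For ANY functional `F` ("what the endpoint at the origin reads"),
`λ(v, T) = F(v, T) − F(−v, T − v)` is antisymmetric: recentring twice returns the pattern.  This is how a
sitewise design (each end reads its own shell) becomes a complementary rule. [folklore] -/
theorem core_antisymm_of_half (F : E3 → Finset E3 → ℝ) (v : E3) (T : Finset E3) :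
    (fun w S => F w S - F (-w) (S.image fun u => u - w)) (-v) (T.image fun u => u - v) =
      -(fun w S => F w S - F (-w) (S.image fun u => u - w)) v T := by
  have himg : ((T.image fun u => u - v).image fun u => u - -v) = T := by
    rw [Finset.image_image]
    convert Finset.image_id (s := T) using 2
    funext u
    simp
  simp only [neg_neg, himg]
  ring

/-- Under `Φ₀ = ½ + λ` the good-neighbour sum is the naive half-split energy plus the transfer sum. [folklore] -/
theorem core_goodSum_halfAdd (a t η₀ R : ℝ) (lam : E3 → Finset E3 → ℝ) {N : ℕ} (x : Fin N → E3)
    (k : Fin N) :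
    goodSum a t η₀ R (fun v T => 1 / 2 + lam v T) x k =
      (1 / 2) * ∑ j ∈ (Finset.univ.erase k).filter
          (fun j => ShellCloseTo η₀ (shell a x j) (target a t)), lennardJones (dist (x k) (x j)) +
      ∑ j ∈ (Finset.univ.erase k).filter (fun j => ShellCloseTo η₀ (shell a x j) (target a t)),
          lam (x j - x k) (bondPattern R x k j) * lennardJones (dist (x k) (x j)) := by
  simp only [goodSum, add_mul, Finset.sum_add_distrib, Finset.mul_sum]

/-! ## §2  The kill criterion: the core forces `|S|·e ≤ E(S)` for every good set `S` -/

/-- Realised patterns are complementary: `T_kj − (x_j − x_k) = T_jk` (the landed `slackDensity_pattern_swap`,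
read through `bondPattern`). [folklore] -/
theorem core_bondPattern_swap (R : ℝ) {N : ℕ} (x : Fin N → E3) (k j : Fin N) :
    (bondPattern R x k j).image (fun u => u - (x j - x k)) = bondPattern R x j k :=
  slackDensity_pattern_swap R x k j

/-- **Kill criterion (necessity of the Hall condition).**  If `PerturbativeCore δ a t η₀ e` holds
(`a ≥ 45/49`, `|t| ≤ 1/100`, `η₀ ≤ a/100`), then for every finite `δ`-separated configuration and every finite
set `S` of GOOD sites, `|S|·e ≤ Σ_{k ∈ S} Σ_{j ∈ S, j ≠ k} ½ V_LJ(r_kj) = E(S)`: sum `e ≤ goodSum_k` over `S`,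
drop the bonds to good sites outside `S` (weight `≥ 0`, `V < 0` at a good site), and symmetrise the `S × S`
part with complementarity.  A configuration violating this for `e = e(hcp(a,h))` refutes the stub. [folklore] -/
theorem core_hall {δ a t η₀ e : ℝ} (hδ : 0 < δ) (ha : 45 / 49 ≤ a) (ht : |t| ≤ 1 / 100)
    (hη : η₀ ≤ a / 100) (hcore : PerturbativeCore δ a t η₀ e) {N : ℕ} {x : Fin N → E3} (hx : Sep δ x)
    (S : Finset (Fin N)) (hS : ∀ k ∈ S, ShellCloseTo η₀ (shell a x k) (target a t)) :
    (S.card : ℝ) * e ≤ ∑ k ∈ S, ∑ j ∈ S.erase k, 1 / 2 * lennardJones (dist (x k) (x j)) := by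
  obtain ⟨R₀, hR₀⟩ := hcore
  obtain ⟨Φ₀, hrule, hge, -⟩ := hR₀ R₀ le_rfl
  have hinj : Function.Injective x := perturbative_injective_of_sep hδ hx
  set g : Fin N → Fin N → ℝ := fun k j =>
    Φ₀ (x j - x k) (bondPattern R₀ x k j) * lennardJones (dist (x k) (x j)) with hg
  -- (1) sum the site inequalities
  have h1 : (S.card : ℝ) * e ≤ ∑ k ∈ S, goodSum a t η₀ R₀ Φ₀ x k := by
    have h := Finset.sum_le_sum fun k hk => hge N x hx k (hS k hk)
    rwa [Finset.sum_const, nsmul_eq_mul] at h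
  -- (2) drop the bonds to good sites outside `S`
  have h2 : ∀ k ∈ S, goodSum a t η₀ R₀ Φ₀ x k ≤ ∑ j ∈ S.erase k, g k j := by
    intro k hk
    set G := (Finset.univ.erase k).filter fun j => ShellCloseTo η₀ (shell a x j) (target a t) with hG
    have hsub : S.erase k ⊆ G := by
      intro j hj
      rw [Finset.mem_erase] at hj
      exact Finset.mem_filter.2 ⟨Finset.mem_erase.2 ⟨hj.1, Finset.mem_univ _⟩, hS j hj.2⟩
    have hsplit := Finset.sum_sdiff (f := g k) hsub
    have hnonpos : ∑ j ∈ G \ S.erase k, g k j ≤ 0 := by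
      refine Finset.sum_nonpos fun j hj => ?_
      have hjG := (Finset.mem_filter.1 (Finset.mem_sdiff.1 hj).1).1
      have hjk : j ≠ k := (Finset.mem_erase.1 hjG).1
      exact mul_nonpos_of_nonneg_of_nonpos (hrule.1 _ _).1
        (perturbative_attractive_of_good ha ht hη (hS k hk) hjk).le
    have : goodSum a t η₀ R₀ Φ₀ x k = ∑ j ∈ G, g k j := rfl
    linarith
  -- (3) symmetrise the `S × S` part
  have hcomp : ∀ k ∈ S, ∀ j ∈ S.erase k, g k j + g j k = lennardJones (dist (x k) (x j)) := by
    intro k _ j hj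
    have hjk : j ≠ k := (Finset.mem_erase.1 hj).1
    have hc := hrule.2 (x j - x k) (bondPattern R₀ x k j) (sub_ne_zero.2 (hinj.ne hjk))
    rw [neg_sub, core_bondPattern_swap] at hc
    simp only [hg, dist_comm (x j) (x k)]
    rw [← add_mul, hc, one_mul]
  have hsymm : ∑ k ∈ S, ∑ j ∈ S.erase k, g k j = ∑ k ∈ S, ∑ j ∈ S.erase k, g j k := by
    have e₁ : ∀ f : Fin N → Fin N → ℝ, ∑ k ∈ S, ∑ j ∈ S.erase k, f k j =
        ∑ k ∈ S, ∑ j ∈ S, if j = k then 0 else f k j := by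
      intro f
      refine Finset.sum_congr rfl fun k _ => ?_
      rw [← Finset.sum_erase S (a := k) (by simp)]
      exact Finset.sum_congr rfl fun j hj => by rw [if_neg (Finset.mem_erase.1 hj).1]
    rw [e₁ g, e₁ fun k j => g j k, Finset.sum_comm]
    refine Finset.sum_congr rfl fun j _ => Finset.sum_congr rfl fun k _ => ?_
    by_cases h : k = j
    · subst h; simp
    · rw [if_neg h, if_neg (Ne.symm h)]
  have hadd : ∑ k ∈ S, ∑ j ∈ S.erase k, g k j + ∑ k ∈ S, ∑ j ∈ S.erase k, g j k =
      ∑ k ∈ S, ∑ j ∈ S.erase k, lennardJones (dist (x k) (x j)) := by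
    rw [← Finset.sum_add_distrib]
    refine Finset.sum_congr rfl fun k hk => ?_
    rw [← Finset.sum_add_distrib]
    exact Finset.sum_congr rfl fun j hj => hcomp k hk j hj
  have hhalf : ∑ k ∈ S, ∑ j ∈ S.erase k, 1 / 2 * lennardJones (dist (x k) (x j)) =
      1 / 2 * ∑ k ∈ S, ∑ j ∈ S.erase k, lennardJones (dist (x k) (x j)) := by
    simp_rw [Finset.mul_sum]
  have h3 : ∑ k ∈ S, ∑ j ∈ S.erase k, g k j =
      ∑ k ∈ S, ∑ j ∈ S.erase k, 1 / 2 * lennardJones (dist (x k) (x j)) := by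
    rw [hhalf]
    linarith [hsymm, hadd]
  calc (S.card : ℝ) * e ≤ ∑ k ∈ S, goodSum a t η₀ R₀ Φ₀ x k := h1
    _ ≤ ∑ k ∈ S, ∑ j ∈ S.erase k, g k j := Finset.sum_le_sum h2
    _ = _ := h3

/-- **Kill criterion in the stub's own setting**: at a family minimiser (`a ≥ 0.97119 > 45/49` by the landed
enclosure) the core at threshold `e` forces `|S|·e ≤ E(S)` for every good set `S` of every finite
`δ`-separated configuration. [folklore] -/
theorem core_hall_familyMin {δ a h t η₀ e : ℝ} (hδ : 0 < δ) (ha : 0 < a) (hh : 0 < h)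
    (hfam : HcpFamilyMin a h) (ht : |t| ≤ 1 / 100) (hη : η₀ ≤ a / 100)
    (hcore : PerturbativeCore δ a t η₀ e) {N : ℕ} {x : Fin N → E3} (hx : Sep δ x)
    (S : Finset (Fin N)) (hS : ∀ k ∈ S, ShellCloseTo η₀ (shell a x k) (target a t)) :
    (S.card : ℝ) * e ≤ ∑ k ∈ S, ∑ j ∈ S.erase k, 1 / 2 * lennardJones (dist (x k) (x j)) := by
  have hA := (abs_le.1 (hcpFamilyMin_enclosure ha hh hfam).1).1
  exact core_hall hδ (by linarith) ht hη hcore hx S hS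

/-! ## §3  First-order inputs at the family minimiser (landed facts, read through `HcpFamilyMin`) -/

/-- `HcpFamilyMin a h` makes `(a, h)` a global minimiser of the total energy function `hcpE` on the open
quadrant (both energies are `hcpE` by the landed series theorem). [folklore] -/
theorem core_hcpE_min {a h : ℝ} (hfam : HcpFamilyMin a h) :
    ∀ a' h' : ℝ, 0 < a' → 0 < h' → hcpE a h ≤ hcpE a' h' := by
  obtain ⟨ha', hh', hmin⟩ := hfam
  intro a₁ h₁ ha₁ hh₁
  have e₀ : hcpE a h = (hcpPeriodicConfiguration ha' hh').energyPerParticle lennardJones :=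
    ((hcpEnergySeries_of_eq a h ha' hh' hcpQ rfl).2.2).symm
  have e₁ : hcpE a₁ h₁ = (hcpPeriodicConfiguration ha₁.ne' hh₁.ne').energyPerParticle lennardJones :=
    ((hcpEnergySeries_of_eq a₁ h₁ ha₁.ne' hh₁.ne' hcpQ rfl).2.2).symm
  rw [e₀, e₁]
  exact hmin a₁ h₁ ha₁.ne' hh₁.ne' ha₁ hh₁

/-- **Zero virial stress at the family minimiser** (the necessary condition for any first-order transfer
design, gap analysis item 2): every entry of the squared-length site stress tensor of `hcp(a, h)` vanishes.
[folklore] -/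
theorem core_zeroStress {a h : ℝ} (ha : 0 < a) (hh : 0 < h) (hfam : HcpFamilyMin a h) :
    ∀ l m : Fin 3, hcpSiteStress a h l m = 0 :=
  stub_zeroStress a h ha hh (core_hcpE_min hfam)

/-- **The two inputs of the first-order design, together**: zero site stress (minimality) and zero partial
force of each sublattice on the root (site symmetry). [folklore] -/
theorem core_firstOrderInputs {a h : ℝ} (ha : 0 < a) (hh : 0 < h) (hfam : HcpFamilyMin a h) :
    (∀ l m : Fin 3, hcpSiteStress a h l m = 0) ∧ ∀ l : Fin 3,
      (∑' v : ℤ × ℤ × ℤ, (if Even v.1 then (0 : ℝ) else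
        ljSqDeriv (‖hcpSite a h v‖ ^ 2) * hcpSite a h v l)) = 0 ∧
      (∑' v : ℤ × ℤ × ℤ, (if Even v.1 then
        ljSqDeriv (‖hcpSite a h v‖ ^ 2) * hcpSite a h v l else (0 : ℝ))) = 0 :=
  ⟨core_zeroStress ha hh hfam, sublatticeForce_vanishes a h ha.ne' hh.ne'⟩

/-! ## §4  Rule-independent far tail -/

/-- **Far tail of any weighted site sum.**  For every hard core `δ > 0` there is `C ≥ 0` such that for every
`δ`-separated finite configuration, every site `k`, every range `L ≥ max δ 1` and all weights `|w_j| ≤ 1`,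
`|Σ_{j ≠ k, r_kj ≥ L} w_j V_LJ(r_kj)| ≤ C L⁻³` — the bonds longer than `L` move at most `C L⁻³` of energy at a
site, whatever the rule does with them (from the landed dyadic tail `stub_farTail`). [folklore] -/
theorem core_weightedTail : ∀ δ : ℝ, 0 < δ → ∃ C : ℝ, 0 ≤ C ∧ ∀ (N : ℕ) (x : Fin N → E3), Sep δ x →
    ∀ (k : Fin N) (L : ℝ), max δ 1 ≤ L → ∀ w : Fin N → ℝ, (∀ j, |w j| ≤ 1) →
      |∑ j ∈ (Finset.univ.erase k).filter (fun j => L ≤ dist (x k) (x j)),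
          w j * lennardJones (dist (x k) (x j))| ≤ C * L⁻¹ ^ 3 := by
  intro δ hδ
  obtain ⟨C, hC, htail⟩ := PricedHcpWindowsFarTail.stub_farTail δ hδ
  refine ⟨1 / 4 * C, by positivity, fun N x hx k L hL w hw => ?_⟩
  have hLδ : δ ≤ L := (le_max_left _ _).trans hL
  have hL1 : 1 ≤ L := (le_max_right _ _).trans hL
  have ht := htail N x hx k L hLδ
  refine (Finset.abs_sum_le_sum_abs _ _).trans ?_
  calc ∑ j ∈ (Finset.univ.erase k).filter (fun j => L ≤ dist (x k) (x j)),
        |w j * lennardJones (dist (x k) (x j))|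
      ≤ ∑ j ∈ (Finset.univ.erase k).filter (fun j => L ≤ dist (x k) (x j)),
          1 / 4 * (dist (x k) (x j))⁻¹ ^ 6 := by
        refine Finset.sum_le_sum fun j hj => ?_
        have hLj : L ≤ dist (x k) (x j) := (Finset.mem_filter.1 hj).2
        rw [abs_mul]
        calc |w j| * |lennardJones (dist (x k) (x j))| ≤ 1 * (1 / 4 * (dist (x k) (x j))⁻¹ ^ 6) :=
              mul_le_mul (hw j) (abs_lennardJones_le (hL1.trans hLj)) (abs_nonneg _) zero_le_one
          _ = _ := one_mul _
    _ = 1 / 4 * ∑ j ∈ (Finset.univ.erase k).filter (fun j => L ≤ dist (x k) (x j)),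
          (dist (x k) (x j))⁻¹ ^ 6 := by rw [Finset.mul_sum]
    _ ≤ 1 / 4 * (C * L⁻¹ ^ 3) := by gcongr
    _ = 1 / 4 * C * L⁻¹ ^ 3 := by ring

/-! ## Registered anchor of this file -/

/-- **Registered anchor `stub_coreHall`** (binder-free form of `core_hall_familyMin`, the KILL CRITERION of
the core): under `PerturbativeCore δ a t η₀ e` at a family minimiser, every finite set `S` of good sites of a
`δ`-separated configuration has `|S|·e ≤ E(S)` (Lennard-Jones energy of the sub-cluster `S`); so a good
cluster with `E(S) < |S|·e(hcp(a,h))` would refute the core (and `e_∞ < e(hcp)` would follow). -/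
theorem stub_coreHall : ∀ δ a h t η₀ e : ℝ, 0 < δ → 0 < a → 0 < h → HcpFamilyMin a h → |t| ≤ 1 / 100 →
    η₀ ≤ a / 100 → PerturbativeCore δ a t η₀ e → ∀ (N : ℕ) (x : Fin N → E3), Sep δ x →
      ∀ S : Finset (Fin N), (∀ k ∈ S, ShellCloseTo η₀ (shell a x k) (target a t)) →
        (S.card : ℝ) * e ≤ ∑ k ∈ S, ∑ j ∈ S.erase k, 1 / 2 * lennardJones (dist (x k) (x j)) :=
  fun _ _ _ _ _ _ hδ ha hh hfam ht hη hcore _ _ hx S hS => core_hall_familyMin hδ ha hh hfam ht hη hcore hx S hS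

end Summit.AtomisticToContinuum.Crystallization.Theorems.StrictSplittingRuleBirth

end
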